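import Literature.Probability.LatticeModels.ConformalCovariance
import Literature.Probability.LatticeModels.IsingThermodynamics
import HarnessLib

/-!
# Strategist census (seat s3, conversation B) — typed statements for `STRATEGY-CENSUS-s3B.md`
# crux stmt-CriticalPhenomena-4801 `MoebiusLimitOfTwoPointLaw`

Signatures only (`Prop`s), no `sorry`, nothing asserted. They make precise two entries of the census:

* `## Strengthen` / `## Transfer` (the in-tree `O(3)` engine, one generator further): covariance under ONE special
  conformal transformation `SCT_b`, `b ≠ 0`, is typed (`IsSCTCovariantAt`); the group-theoretic half
  `OneSCTUpgrade` (Euclid + scale + one SCT ⇒ unit inversion) is the provable part (parabolic subgroup `Sim(3)` is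
  maximal in `Möb(3)`; cf. the landed words of `wardToMoebius`, item 5357), and `OneSCTFromIsing` is the open half —
  item 1982 verbatim up to `OneSCTUpgrade`.
* `## Negation` (cluster-set form of non-existence): `twistedDilate` is the action of the dilation group on
  candidate limits; `IsScaleCovariant Δ S ↔ ∀ λ > 0, twistedDilate Δ λ S = S` (`isScaleCovariant_iff_twistedDilate`),
  and a `×2`-covariant family that is not scale covariant (`LogPeriodicFamily`) is the typed shape of the only
  non-existence scenario compatible with the two-point law along the full filter.
-/

noncomputable section

namespace Summit.CriticalPhenomena.Ising3DConformalLimit.Cruxes.MoebiusLimitOfTwoPointLaw.StrategistCensusB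

open Literature.Probability.LatticeModels

/-- Points of `ℝ³`. -/
abbrev E3 : Type := EuclideanSpace ℝ (Fin 3)

/-- The conformal weight denominator of the special conformal transformation with parameter `b` at `x`:
`σ_b(x) = 1 + 2⟪b,x⟫ + ‖b‖²‖x‖²` (`= ‖b‖² ‖x + b/‖b‖²‖²` for `b ≠ 0`; it vanishes exactly at the pole). -/
def sctDenom (b x : E3) : ℝ := 1 + 2 * inner ℝ b x + ‖b‖ ^ 2 * ‖x‖ ^ 2

/-- The special conformal transformation `SCT_b(x) = (x + ‖x‖² b) / σ_b(x)` (`= ι ∘ τ_b ∘ ι` off the poles). -/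
def sct (b x : E3) : E3 := (sctDenom b x)⁻¹ • (x + ‖x‖ ^ 2 • b)

/-- Covariance of a correlation family under ONE special conformal transformation `SCT_b`, with scaling dimension
`Δ`, at all pole-free configurations: `S n (SCT_b x₁, …, SCT_b xₙ) = (∏ᵢ σ_b(xᵢ)^Δ) · S n x`
(conformal factor `Ω = σ_b⁻¹`, field weight `Ω^{-Δ}`, the same convention as `IsInversionCovariant`). -/
def IsSCTCovariantAt (Δ : ℝ) (b : E3) (S : CorrFamily 3) : Prop :=
  ∀ n (x : Fin n → E3), (∀ i, sctDenom b (x i) ≠ 0) →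
    S n (fun i => sct b (x i)) = (∏ i, sctDenom b (x i) ^ Δ) * S n x

/-- **S⁺, provable half (group lemma).** A normalised, Euclidean-invariant, scale-covariant family covariant under a
single `SCT_b` with `b ≠ 0` is unit-inversion covariant (hence Möbius covariant): `O(3)` conjugates `SCT_b` to every
`SCT_{b'}` with `‖b'‖ = ‖b‖`, dilations to every norm, and `ι ∘ R_b = τ_{-b} ∘ SCT_b ∘ τ_{-b}` (a reflect-invert), whence
`ι`. Equivalent formulation: `Sim(3)` is a maximal subgroup of `Möb(3)`. -/
def OneSCTUpgrade : Prop :=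
  ∀ (Δ : ℝ) (b : E3) (S : CorrFamily 3), b ≠ 0 →
    (∀ n z, z ∉ NonCoincident 3 n → S n z = 0) →
    (∀ n, ContinuousOn (S n) (NonCoincident 3 n)) →
    IsEuclideanInvariant S → IsScaleCovariant Δ S → IsSCTCovariantAt Δ b S → IsInversionCovariant Δ S

/-- **S⁺, open half = item 1982 up to `OneSCTUpgrade`.** Every normalised, non-degenerate, Euclidean, scale-covariant
pointwise limit of the critical `ℤ³` correlators is covariant under at least one non-trivial special conformal
transformation. No lattice shadow of any `SCT_b` is known (lattice mirrors generate isometries only). -/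
def OneSCTFromIsing : Prop :=
  ∀ (ρ : ℝ → ℝ) (Δ : ℝ) (S : CorrFamily 3), (∀ δ ∈ Set.Ioc (0:ℝ) 1, 0 < ρ δ) →
    HasPointwiseScalingLimit (criticalCorr 3) ρ S →
    (∀ n z, z ∉ NonCoincident 3 n → S n z = 0) → IsNondegenerateTwoPoint S →
    IsEuclideanInvariant S → IsScaleCovariant Δ S → ∃ b : E3, b ≠ 0 ∧ IsSCTCovariantAt Δ b S

/-- The action of the dilation `λ > 0` on candidate limits of dimension `Δ`:
`(D_λ S) n x = λ^{nΔ} · S n (λ x)`. Cluster points of the `δ^{-Δ}`-renormalised correlators form a `D`-invariant set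
(the cluster point along `δ_k` is carried to the cluster point along `δ_k/λ` by the exact mesh identity). -/
def twistedDilate (Δ lam : ℝ) (S : CorrFamily 3) : CorrFamily 3 :=
  fun n x => lam ^ ((n : ℝ) * Δ) * S n (fun i => lam • x i)

/-- Scale covariance is exactly `D`-invariance. -/
theorem isScaleCovariant_iff_twistedDilate (Δ : ℝ) (S : CorrFamily 3) :
    IsScaleCovariant Δ S ↔ ∀ lam : ℝ, 0 < lam → twistedDilate Δ lam S = S := by
  constructor
  · intro h lam hlam
    funext n x
    simp only [twistedDilate]
    rw [h n lam hlam x, ← mul_assoc, ← Real.rpow_add hlam]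
    have : (n : ℝ) * Δ + -(n : ℝ) * Δ = 0 := by ring
    rw [this, Real.rpow_zero, one_mul]
  · intro h n c hc x
    have key := congrFun (congrFun (h c hc) n) x
    simp only [twistedDilate] at key
    have hpos : 0 < c ^ ((n : ℝ) * Δ) := Real.rpow_pos_of_pos hc _
    have hinv : c ^ (-(n : ℝ) * Δ) = (c ^ ((n : ℝ) * Δ))⁻¹ := by
      rw [← Real.rpow_neg hc.le]; ring_nf
    rw [hinv, eq_inv_mul_iff_mul_eq₀ hpos.ne', ← key]

/-- The typed shape of the one non-existence scenario compatible with the two-point law along the FULL filter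
(arity 2 settled, translations / `O(3)` / `×2`-covariance free or proved): an even-arity family covariant under the
dilation `×2` but not under all dilations ("log-periodic modulation"), i.e. a non-trivial periodic orbit of the
dilation flow on the cluster set. Excluding it for `criticalCorr 3` is the existence half (item 4738 under 0634);
a Lyapunov functional monotone along `D`-orbits of Ising cluster points would exclude periodic orbits but NOT a
continuum of distinct `D`-fixed cluster points, so even that (unknown) object would not give existence. -/
def LogPeriodicFamily (Δ : ℝ) (S : CorrFamily 3) : Prop :=
  twistedDilate Δ 2 S = S ∧ ¬ IsScaleCovariant Δ S

end Summit.CriticalPhenomena.Ising3DConformalLimit.Cruxes.MoebiusLimitOfTwoPointLaw.StrategistCensusB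

end
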